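import Mathlib
import Literature.Analysis.Calculus.SardProofs
import Literature.Topology.PlaneTopology.Janiszewski
import Summits.NavierStokesRegularity.NavierStokesRegularity.Theorems.UnthreadedDoorNetFluxEnvelopeRegularity
import Summits.NavierStokesRegularity.NavierStokesRegularity.Theorems.UnthreadedDoorNetFluxEnvelopeDefs
import Summits.NavierStokesRegularity.NavierStokesRegularity.Cruxes.PoloidalLiouville.NetFluxTransportSketch

/-!
# NF-1a PLAN — sub-lemma toolkit for `stub_extremalHeadEMF` (`NetFlux.ExtremalHeadEMF`, hinge (a), the hardest stub of
# line «netflux-typei-gap» v5), crux stmt-NavierStokesRegularity-1222, planner ns-idea-14 g3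

Workfile (sorries allowed; NOT a registered skeleton; progress 0 on the crux; NS regularity NOT proved).  It records the
planner's proof route for NF-1a as TYPED sub-lemmas a prover can take `--supports stmt-NavierStokesRegularity-1222`, and ONE
kernel-checked reduction: the single «level-Lipschitz lemma» (Λ) gives parts (i) choice-independence and (iv) the EMF bound
`|I| ≤ V · netFlux` of `ExtremalHeadEMF` (`core_of_levelLipschitz`, no sorry).  Parts (ii) continuity, (iii) Lipschitz-in-`r`,
(v) a.e. slope are the assembly «Δ» described at the end (they use (Λ) on nearby spheres + Danskin for `r ↦ max/min_{S_r}T`,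
which qj-p1 landed: `ae_differentiableAt_rsphSup`, `fderiv_rsphSup_eq_fderiv_slice`, `exists_lipschitzOnWith_rsphSup`).

## The route (why no Jordan curve theorem, no coarea formula, no Whitney pathology)
Fix `t`, `r > 0`, `S = S_r(x₀)`, `f = T(t)|_S` (smooth), `g = P(t)|_S` (`C¹`), `μ = ⟪v(t,·), · − x₀⟫|_S` (smooth, `|μ| ≤ rV`);
the head hypothesis says `∇_S g = μ ∇_S f`.  Then `g ∘ chart` is `C¹` with a SMOOTH gradient, hence smooth: Sard (the tree's
`Literature.Analysis.Calculus.sard_holds`, `m = 2, n = 1`) applies to `g` and to every `q_L = g − L f`.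
* (T)  UNICOHERENCE of the 2-sphere: `A, B` closed connected, `A ∪ B = S` ⇒ `A ∩ B` connected.  Eilenberg's argument: a map
       `φ : S → S¹` built from Urysohn functions (`θ_A = 0/π` on the two pieces of `A ∩ B` inside `A`, `θ_B = 0/−π` inside `B`)
       would have no continuous logarithm, but every nonvanishing map on `S` has one (stereographic projection from a point +
       `Literature.Topology.PlaneTopology.Janiszewski.exists_continuous_log` on `ℂ` + patching at the pole).       `stub_sphere_unicoherent`
* (T′) unimodal (`IsUnimodalSphere`: all strict super/sub-level sets connected) ⇒ EVERY level set `{f = c}` is connected: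
       `{f ≥ c} = ⋂_{c'<c} cl{f > c'}` (nested compact connected ⇒ connected, tree: `isPreconnected_iInter_of_antitone…`), same for
       `{f ≤ c}`, union `= S`, then (T).                                                                  `stub_levelSet_preconnected`
* (An1) `g` is constant on every connected `Z ⊆ {f = c}`: at `f`-regular points of `Z`, `g|_Z` is locally constant (the level set
       is locally one arc, `∂_τ g = μ ∂_τ f = 0`); `f`-critical points of `Z` are critical for `g`, so their `g`-values form a null
       set (Sard); a continuous function on a connected set that is locally constant off a closed part with null image is constant
       (clopen argument).                                                                      `stub_const_on_preconnected_levelSubset`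
* (An2) on an interval of regular values, `G(c) := g|_{f=c}` is differentiable with `G'(c) = μ(any point of the level)`, so
       `|G'| ≤ L` (1-variable implicit function along `∇f`; S-sized, inside (Λ)).
* (An3) LAST-CROSSING LEMMA (pure 1-D): `Q` continuous on `[a,b]`, locally non-increasing to the right off a closed set `C`,
       `Q(C)` null ⇒ `Q(b) ≤ Q(a)`.  Applied to `Q = G − L·(c − a)` whose values on the critical values `C` of `f` are values of
       `q_L = g − Lf` at CRITICAL points of `q_L` (`∇q_L = (μ − L)∇f = 0` there) — null by Sard for `q_L`.  This is exactly what
       kills the Cantor-staircase scenario (`G' = μ` off a null set does NOT bound the increment by itself).   `stub_lastCrossing`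
* (Λ)  LEVEL-LIPSCHITZ LEMMA: `|g x − g y| ≤ L |f x − f y|` on a unimodal sphere.  ⇒ (i) and (iv) of `ExtremalHeadEMF`
       (`core_of_levelLipschitz`, PROVED below).                                                         `stub_levelLipschitz`
* (Δ)  assembly of (ii),(iii),(v): `I(t,r) = ∫_γ m dT` along ANY `C¹` path on `S_r` (path-independence = the head hypothesis per
       slice, so NO regularity of `P` in `t` is needed); compare `(t',r')` with `(t,r)` along the radially SCALED path plus end
       corrections `g_{r'}(x^±(r')) − g_{r'}(x̃^±)`, which (Λ) on `S_{r'}` bounds by `r'V·|max_{S_{r'}}T − T(x̃⁺)| = O(|r'−r|)`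
       (Lipschitz of `r ↦ max_{S_r}T`, qj-p1) and `= o(|r'−r|)` at Danskin points (`∂_r max = ∂_r T(x⁺)` for EVERY maximiser), giving
       `∂_r I = ∂_r P(x⁺) − ∂_r P(x⁻)` for every choice, a.e. — in particular (v).
-/

noncomputable section

open Set Function Filter Topology MeasureTheory
open scoped RealInnerProductSpace

namespace Summit.NavierStokesRegularity.NavierStokesRegularity.Cruxes.PoloidalLiouville.NetFlux.NF1a

open Summit.NavierStokesRegularity.NavierStokesRegularity.Cruxes.PoloidalLiouville
open Summit.NavierStokesRegularity.NavierStokesRegularity.Cruxes.PoloidalLiouville.NetFlux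
open Literature.Analysis.FluidPDE

/-! ### Typed sub-lemmas (stubs; each TRUE classically — sources in the docstrings) -/

/-- (log-lift) Every continuous nonvanishing `φ : S_r(x₀) → ℂ` has a continuous logarithm (the 2-sphere is simply connected;
stereographic chart + `Janiszewski.exists_continuous_log` + patching at the pole).  [Eilenberg 1936; Kuratowski, Topology II §57] -/
theorem stub_exists_log_sphere (x₀ : E3) {r : ℝ} (hr : 0 < r) (φ : E3 → ℂ)
    (hφ : ContinuousOn φ (Metric.sphere x₀ r)) (h0 : ∀ x ∈ Metric.sphere x₀ r, φ x ≠ 0) :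
    ∃ ψ : E3 → ℂ, ContinuousOn ψ (Metric.sphere x₀ r) ∧ ∀ x ∈ Metric.sphere x₀ r, Complex.exp (ψ x) = φ x := by
  sorry

/-- (T) The 2-sphere is UNICOHERENT.  [Kuratowski, Topology II §57; Whyburn, Analytic Topology XI; Eilenberg's criterion] -/
theorem stub_sphere_unicoherent (x₀ : E3) {r : ℝ} (hr : 0 < r) {A B : Set E3}
    (hA : IsClosed A) (hB : IsClosed B) (hAc : IsPreconnected A) (hBc : IsPreconnected B)
    (hAs : A ⊆ Metric.sphere x₀ r) (hBs : B ⊆ Metric.sphere x₀ r) (hAB : Metric.sphere x₀ r ⊆ A ∪ B) :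
    IsPreconnected (A ∩ B) := by
  sorry

/-- (T′) On a unimodal sphere every level set is connected. -/
theorem stub_levelSet_preconnected (f : E3 → ℝ) (x₀ : E3) {r : ℝ} (hr : 0 < r)
    (hf : ContinuousOn f (Metric.sphere x₀ r)) (hU : IsUnimodalSphere f x₀ r) (c : ℝ) :
    IsPreconnected {x : E3 | ‖x - x₀‖ = r ∧ f x = c} := by
  sorry

/-- (An1) Sard-constancy: `∇_S g = μ ∇_S f` (tangentially on the sphere, `f, μ` smooth, `g ∈ C¹` off the centre) forces `g` to be
constant on every connected subset of a level set of `f|_S`.  (`Literature.Analysis.Calculus.sard_holds` with `m = 2`, `n = 1`,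
applied to `g ∘ chart`, which is smooth because its gradient `(μ ∇ f) ∘ chart` is.) -/
theorem stub_const_on_preconnected_levelSubset (f g μ : E3 → ℝ) (x₀ : E3) {r : ℝ} (hr : 0 < r)
    (hf : ContDiffOn ℝ (⊤ : ℕ∞) f ({x₀}ᶜ : Set E3)) (hg : ContDiffOn ℝ 1 g ({x₀}ᶜ : Set E3))
    (hμ : ContDiffOn ℝ (⊤ : ℕ∞) μ ({x₀}ᶜ : Set E3))
    (hpar : ∀ x ∈ Metric.sphere x₀ r, cross (gradient g x - μ x • gradient f x) (x - x₀) = 0)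
    {c : ℝ} {Z : Set E3} (hZ : Z ⊆ {x : E3 | ‖x - x₀‖ = r ∧ f x = c}) (hZc : IsPreconnected Z) :
    ∀ x ∈ Z, ∀ y ∈ Z, g x = g y := by
  sorry

/-- (An3) LAST-CROSSING LEMMA (pure 1-D real analysis). -/
theorem stub_lastCrossing (Q : ℝ → ℝ) {a b : ℝ} (hab : a ≤ b) (C : Set ℝ) (hC : IsClosed C)
    (hQ : ContinuousOn Q (Icc a b))
    (hdec : ∀ x ∈ Ico a b, x ∉ C → ∃ δ > 0, ∀ y ∈ Ioo x (x + δ), Q y ≤ Q x)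
    (hnull : volume (Q '' (C ∩ Icc a b)) = 0) : Q b ≤ Q a := by
  sorry

/-- **(Λ) THE LEVEL-LIPSCHITZ LEMMA** — the analytic-topological heart of hinge (a): on a unimodal sphere, a `C¹` function whose
tangential gradient is `μ` times that of the smooth unimodal `f`, `|μ| ≤ L`, is `L`-Lipschitz AS A FUNCTION OF THE VALUES OF `f`. -/
def LevelLipschitz : Prop :=
  ∀ (f g μ : E3 → ℝ) (x₀ : E3) (r L : ℝ), 0 < r →
    ContDiffOn ℝ (⊤ : ℕ∞) f ({x₀}ᶜ : Set E3) → ContDiffOn ℝ 1 g ({x₀}ᶜ : Set E3) →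
    ContDiffOn ℝ (⊤ : ℕ∞) μ ({x₀}ᶜ : Set E3) →
    (∀ x ∈ Metric.sphere x₀ r, cross (gradient g x - μ x • gradient f x) (x - x₀) = 0) →
    (∀ x ∈ Metric.sphere x₀ r, |μ x| ≤ L) → IsUnimodalSphere f x₀ r →
    ∀ x ∈ Metric.sphere x₀ r, ∀ y ∈ Metric.sphere x₀ r, |g x - g y| ≤ L * |f x - f y|

/-- (Λ) as a stub: from (T′), (An1), (An2), (An3) as in the module docstring. -/
theorem stub_levelLipschitz : LevelLipschitz := by
  sorry

/-! ### The kernel-checked reduction: (Λ) ⇒ parts (i) and (iv) of `ExtremalHeadEMF` -/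

/-- Parts (i) (choice-independence of the extremal head difference) and (iv) (the EMF bound `|I| ≤ V · netFlux`) of
`NetFlux.ExtremalHeadEMF`, with the same binders (stated against the Theorems-side twins of `sphArgmax` / `sphArgmin`, which are
definitionally the line's). -/
def ExtremalHeadCore : Prop :=
  ∀ (v : ℝ → E3 → E3) (x₀ : E3) (T P : ℝ → E3 → ℝ) (V : ℝ → ℝ) (t₀ : ℝ),
    ContDiffOn ℝ (⊤ : ℕ∞) (uncurry v) (Ioo t₀ 0 ×ˢ univ) →
    ContDiffOn ℝ (⊤ : ℕ∞) (uncurry T) (Ioo t₀ 0 ×ˢ ({x₀}ᶜ : Set E3)) →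
    (∀ t ∈ Ioo t₀ 0, ContDiffOn ℝ 1 (P t) ({x₀}ᶜ : Set E3)) →
    (∀ t ∈ Ioo t₀ 0, ∀ x, ‖v t x‖ ≤ V t) →
    (∀ t ∈ Ioo t₀ 0, ∀ x, x ≠ x₀ →
        cross (gradient (P t) x - (inner ℝ (v t x) (x - x₀)) • gradient (T t) x) (x - x₀) = 0) →
    (∀ t ∈ Ioo t₀ 0, ∀ r > 0, IsUnimodalSphere (T t) x₀ r) →
    ∀ t ∈ Ioo t₀ 0, ∀ r > 0,
      (∀ xp ∈ Theorems.PoloidalLiouville.NetFlux.sphArgmax (T t) x₀ r,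
        ∀ xp' ∈ Theorems.PoloidalLiouville.NetFlux.sphArgmax (T t) x₀ r,
        ∀ xm ∈ Theorems.PoloidalLiouville.NetFlux.sphArgmin (T t) x₀ r,
        ∀ xm' ∈ Theorems.PoloidalLiouville.NetFlux.sphArgmin (T t) x₀ r,
          P t xp - P t xm = P t xp' - P t xm') ∧
      (∀ xp ∈ Theorems.PoloidalLiouville.NetFlux.sphArgmax (T t) x₀ r,
        ∀ xm ∈ Theorems.PoloidalLiouville.NetFlux.sphArgmin (T t) x₀ r,
          |P t xp - P t xm| ≤ V t * netFlux (T t) x₀ r)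

theorem core_of_levelLipschitz (hΛ : LevelLipschitz) : ExtremalHeadCore := by
  intro v x₀ T P V t₀ hv hT hP hV hcross hUni t ht r hr
  -- the data of (Λ) on the sphere `S_r(x₀)` at time `t`
  have hf : ContDiffOn ℝ (⊤ : ℕ∞) (T t) ({x₀}ᶜ : Set E3) :=
    hT.comp (contDiff_prodMk_right t).contDiffOn fun _ hx => ⟨ht, hx⟩
  have hvt : ContDiffOn ℝ (⊤ : ℕ∞) (v t) (univ : Set E3) :=
    hv.comp (contDiff_prodMk_right t).contDiffOn fun x _ => ⟨ht, mem_univ x⟩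
  have hμ : ContDiffOn ℝ (⊤ : ℕ∞) (fun x => inner ℝ (v t x) (x - x₀)) ({x₀}ᶜ : Set E3) :=
    (hvt.mono (subset_univ _)).inner ℝ (contDiffOn_id.sub contDiffOn_const)
  have hVnn : 0 ≤ V t := (norm_nonneg _).trans (hV t ht x₀)
  have hL : ∀ x ∈ Metric.sphere x₀ r, |inner ℝ (v t x) (x - x₀)| ≤ V t * r := by
    intro x hx
    have hxr : ‖x - x₀‖ = r := mem_sphere_iff_norm.mp hx
    calc |inner ℝ (v t x) (x - x₀)| ≤ ‖v t x‖ * ‖x - x₀‖ := abs_real_inner_le_norm _ _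
      _ ≤ V t * r := by
          rw [hxr]; exact mul_le_mul_of_nonneg_right (hV t ht x) hr.le
  have hpar : ∀ x ∈ Metric.sphere x₀ r,
      cross (gradient (P t) x - (inner ℝ (v t x) (x - x₀)) • gradient (T t) x) (x - x₀) = 0 :=
    fun x hx => hcross t ht x (Metric.ne_of_mem_sphere hx hr.ne')
  have key := hΛ (T t) (P t) (fun x => inner ℝ (v t x) (x - x₀)) x₀ r (V t * r) hr hf (hP t ht) hμ hpar hL
    (hUni t ht r hr)
  -- values of `T t` agree on argmax (resp. argmin), hence so do the values of `P t`
  have hTmax : ∀ xp ∈ Theorems.PoloidalLiouville.NetFlux.sphArgmax (T t) x₀ r,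
      ∀ xp' ∈ Theorems.PoloidalLiouville.NetFlux.sphArgmax (T t) x₀ r, T t xp = T t xp' :=
    fun xp hxp xp' hxp' => le_antisymm (hxp'.2 xp hxp.1) (hxp.2 xp' hxp'.1)
  have hTmin : ∀ xm ∈ Theorems.PoloidalLiouville.NetFlux.sphArgmin (T t) x₀ r,
      ∀ xm' ∈ Theorems.PoloidalLiouville.NetFlux.sphArgmin (T t) x₀ r, T t xm = T t xm' :=
    fun xm hxm xm' hxm' => le_antisymm (hxm.2 xm' hxm'.1) (hxm'.2 xm hxm.1)
  have hPeq : ∀ x ∈ Metric.sphere x₀ r, ∀ y ∈ Metric.sphere x₀ r, T t x = T t y → P t x = P t y := by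
    intro x hx y hy hxy
    have h := key x hx y hy
    rw [hxy, sub_self, abs_zero, mul_zero] at h
    exact eq_of_abs_sub_nonpos h
  refine ⟨fun xp hxp xp' hxp' xm hxm xm' hxm' => ?_, fun xp hxp xm hxm => ?_⟩
  · rw [hPeq xp hxp.1 xp' hxp'.1 (hTmax xp hxp xp' hxp'), hPeq xm hxm.1 xm' hxm'.1 (hTmin xm hxm xm' hxm')]
  · -- `netFlux = r · (max − min) = r · (T xp − T xm)`
    have hcont : ContinuousOn (T t) (Metric.sphere x₀ r) :=
      hf.continuousOn.mono fun x hx => Metric.ne_of_mem_sphere hx hr.ne'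
    have hsup : sphSup (T t) x₀ r = T t xp := by
      refine IsGreatest.csSup_eq ⟨⟨xp, hxp.1, rfl⟩, ?_⟩
      rintro _ ⟨y, hy, rfl⟩
      exact hxp.2 y hy
    have hinf : sphInf (T t) x₀ r = T t xm := by
      refine IsLeast.csInf_eq ⟨⟨xm, hxm.1, rfl⟩, ?_⟩
      rintro _ ⟨y, hy, rfl⟩
      exact hxm.2 y hy
    have hge : T t xm ≤ T t xp := hxp.2 xm hxm.1
    have h := key xp hxp.1 xm hxm.1
    have hnf : netFlux (T t) x₀ r = r * (T t xp - T t xm) := by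
      simp only [netFlux, sphOsc, hsup, hinf]
    rw [hnf, abs_of_nonneg (sub_nonneg.mpr hge)] at *
    calc |P t xp - P t xm| ≤ V t * r * (T t xp - T t xm) := h
      _ = V t * (r * (T t xp - T t xm)) := by ring

end Summit.NavierStokesRegularity.NavierStokesRegularity.Cruxes.PoloidalLiouville.NetFlux.NF1a

end
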